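import Summits.NavierStokesRegularity.NavierStokesRegularity.Theorems.TerminalTraceTypeITraceScarL3NoConcentrationViscosity
import Summits.NavierStokesRegularity.NavierStokesRegularity.Theorems.TerminalTraceTypeITraceScarL3TopFluxIntegrable

set_option linter.dupNamespace false

/-!
# The local energy identity up to a Type-I blow-up time (no anomalous dissipation)

Summits-side helper file for the crux `TerminalTrace.TypeITraceScarL3`
(item `stmt-NavierStokesRegularity-18385`; Navier–Stokes regularity is **not** proved here and
this file does not close the item). For the binders of the item — `(u, p)` classical on
`[0, T) × ℝ³` with viscosity `ν > 0`, Leray–Hopf on `[0, T)`, **Type I in time** at `T` — and every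
cut-off `0 ≤ φ ∈ C_c^∞(ℝ³)` and `t₀ ∈ (0, T)`:

* `integrableOn_dissipation_Ioo` (no Type I needed) — the localised dissipation
  `s ↦ ∫ |∇u(s)|² φ` is integrable on `(t₀, T)` (monotone limit of the cut-off energy balance below
  `T`, the flux being integrable up to `T`, `integrableOn_flux_Ioo`);
* `tendsto_integral_cutoff_normSq_nhdsLT` (no Type I needed) — the cut-off energy `∫ φ|u(t)|²`
  HAS a left limit at `T`, namely `∫ φ|u(t₀)|² − 2ν∫_{t₀}^{T}∫|∇u|²φ + ∫_{t₀}^{T} F_φ`;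
* `tendsto_integral_cutoff_normSq_top` (Type I) — that left limit is the value AT `T`:
  `∫ φ|u(t)|² → ∫ φ|u(T)|²` as `t ↑ T` (weak `L²` continuity of the Leray–Hopf slices plus the
  no-concentration theorem `tendsto_localEnergy_sub_top`);
* `localEnergyIdentity_top` (Type I) — **the local energy identity holds up to and including the
  blow-up time**:
  `∫ φ|u(T)|² − ∫ φ|u(t₀)|² + 2ν ∫_{(t₀,T)} ∫ |∇u|² φ = ∫_{(t₀,T)} ∫ (νΔφ|u|² + Dφ(u)|u|² + 2 p Dφ(u))`,
  i.e. the local energy inequality of Caffarelli–Kohn–Nirenberg is an EQUALITY at `t = T` for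
  every cut-off: a Type-I blow-up carries no anomalous (defect) dissipation.

In print, in substance: Leslie–Shvydkoy 2018, Thm. 1.2 (energy equality for Type-I-in-time
blow-up, global form); the localised form with a cut-off is the same argument. The tree's route is
formal: classical local energy identity below `T` (`local_energy_identity_cutoff`), integrability
of flux and dissipation up to `T`, and the no-concentration theorem of
`…NoConcentrationViscosity.lean` (CKN ε-regularity in Morrey form + Federer covering).

## References

* T. M. Leslie, R. Shvydkoy, SIAM J. Math. Anal. 50 (2018), Thm. 1.2, §4. [LeslieShvydkoy2017]
* L. Caffarelli, R. Kohn, L. Nirenberg, CPAM 35 (1982), §2 (2.5). [CaffarelliKohnNirenberg1982]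
-/

noncomputable section

open MeasureTheory TopologicalSpace Set Function Filter Metric
open _root_.Topology
open scoped Laplacian InnerProductSpace RealInnerProductSpace ENNReal NNReal ContDiff

namespace Summit.NavierStokesRegularity.NavierStokesRegularity.Theorems.TypeITraceScarL3

open Literature.Analysis.FluidPDE

/-- The primitive `t ↦ ∫_a^t f` of a function integrable on `(a, b)` tends to `∫_{(a,b)} f` as
`t ↑ b`. [folklore] -/
theorem tendsto_intervalIntegral_nhdsLT {f : ℝ → ℝ} {a b : ℝ} (hab : a < b)
    (hf : IntegrableOn f (Ioo a b)) :
    Tendsto (fun t => ∫ s in a..t, f s) (𝓝[<] b) (𝓝 (∫ s in Ioo a b, f s)) := by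
  have hf' : IntegrableOn f (Ioc a b) := hf.congr_set_ae Ioo_ae_eq_Ioc.symm
  have hii : IntervalIntegrable f volume (min a a) (max a b) := by
    rw [min_self, max_eq_right hab.le]
    exact (intervalIntegrable_iff_integrableOn_Ioc_of_le hab.le).2 hf'
  have hcont := intervalIntegral.continuousWithinAt_primitive (measure_singleton b) hii
  have hval : ∫ s in a..b, f s = ∫ s in Ioo a b, f s := by
    rw [intervalIntegral.integral_of_le hab.le, integral_Ioc_eq_integral_Ioo]
  rw [← hval, ← nhdsWithin_Ioo_eq_nhdsLT hab]
  exact hcont.tendsto.mono_left (nhdsWithin_mono _ Ioo_subset_Icc_self)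

/-- **The localised dissipation is integrable up to the blow-up time** (no Type-I hypothesis).
For the item's classical Leray–Hopf solution, `0 ≤ φ ∈ C_c^∞(ℝ³)` and `t₀ ∈ (0, T)`,
`s ↦ ∫ |∇u(s)|² φ ∈ L¹(t₀, T)`: by the cut-off energy identity below `T`,
`2ν ∫_{t₀}^{t₁} ∫|∇u|²φ = ∫_{t₀}^{t₁} F_φ − ∫φ|u(t₁)|² + ∫φ|u(t₀)|² ≤ ‖F_φ‖_{L¹(t₀,T)} + ∫φ|u(t₀)|²`
for every `t₁ < T`, and the integrand is nonnegative and continuous below `T`.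
[cite: LeslieShvydkoy2017, Thm. 1.2; CaffarelliKohnNirenberg1982, §2 (2.5)] -/
theorem integrableOn_dissipation_Ioo {ν T : ℝ} (hν : 0 < ν) (hT : 0 < T)
    {u : ℝ → EuclideanSpace ℝ (Fin 3) → EuclideanSpace ℝ (Fin 3)}
    {p : ℝ → EuclideanSpace ℝ (Fin 3) → ℝ}
    (hcl : IsClassicalNSSolutionOn (Set.Ico 0 T) ν 0 u p) (hLH : IsLerayHopfOn T ν 0 (u 0) u)
    {φ : EuclideanSpace ℝ (Fin 3) → ℝ} (hφ : ContDiff ℝ ∞ φ) (hφc : HasCompactSupport φ)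
    (hφ0 : ∀ x, 0 ≤ φ x) {t₀ : ℝ} (ht₀ : t₀ ∈ Ioo 0 T) :
    IntegrableOn (fun s => ∫ x, frobeniusNormSq (fderiv ℝ (u s) x) * φ x) (Ioo t₀ T) := by
  have hcl' : IsClassicalNSSolutionOn (Ioo 0 T) ν 0 u p :=
    hcl.mono Ioo_subset_Ico_self isOpen_Ioo.uniqueDiffOn
  set D : ℝ → ℝ := fun s => ∫ x, frobeniusNormSq (fderiv ℝ (u s) x) * φ x with hDdef
  set L : ℝ → ℝ := fun s => ∫ x, φ x * ‖u s x‖ ^ 2 with hLdef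
  set F : ℝ → ℝ := fun s => ∫ x, (ν * ((Δ φ) x * ‖u s x‖ ^ 2) +
      fderiv ℝ φ x (u s x) * ‖u s x‖ ^ 2 + 2 * (p s x * fderiv ℝ φ x (u s x))) with hFdef
  have hFint : IntegrableOn F (Ioo t₀ T) :=
    (integrableOn_flux_Ioo hν hT hcl hLH hφ hφc).mono_set (Ioo_subset_Ioo_left ht₀.1.le)
  have cD : ContinuousOn D (Ioo 0 T) :=
    hcl'.continuousOn_integral_dissipation_cutoff isOpen_Ioo hφ.continuous hφc
  have hD0 : ∀ s, 0 ≤ D s := fun s =>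
    integral_nonneg fun x => mul_nonneg (frobeniusNormSq_nonneg _) (hφ0 x)
  have hL0 : ∀ s, 0 ≤ L s := fun s => integral_nonneg fun x => mul_nonneg (hφ0 x) (sq_nonneg _)
  -- the uniform bound of the partial dissipation integrals
  set M : ℝ := (∫ s in Ioo t₀ T, ‖F s‖) + L t₀ with hM
  have hbound : ∀ t₁ ∈ Ico t₀ T, ∫ s in Ioc t₀ t₁, ‖D s‖ ≤ M / (2 * ν) := by
    intro t₁ ht₁
    have hI : Icc t₀ t₁ ⊆ Ioo 0 T := fun s hs => ⟨ht₀.1.trans_le hs.1, hs.2.trans_lt ht₁.2⟩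
    have hid : L t₁ - L t₀ + 2 * ν * ∫ s in t₀..t₁, D s = ∫ s in t₀..t₁, F s :=
      hcl'.local_energy_identity_cutoff isOpen_Ioo hφ hφc ht₁.1 hI
    have e1 : ∫ s in Ioc t₀ t₁, ‖D s‖ = ∫ s in t₀..t₁, D s := by
      rw [intervalIntegral.integral_of_le ht₁.1]
      refine setIntegral_congr_fun measurableSet_Ioc fun s _ => ?_
      rw [Real.norm_eq_abs, abs_of_nonneg (hD0 s)]
    have e2 : ∫ s in t₀..t₁, F s ≤ ∫ s in Ioo t₀ T, ‖F s‖ := by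
      rw [intervalIntegral.integral_of_le ht₁.1]
      calc ∫ s in Ioc t₀ t₁, F s ≤ ‖∫ s in Ioc t₀ t₁, F s‖ := Real.le_norm_self _
        _ ≤ ∫ s in Ioc t₀ t₁, ‖F s‖ := norm_integral_le_integral_norm _
        _ ≤ ∫ s in Ioo t₀ T, ‖F s‖ :=
            setIntegral_mono_set hFint.norm (Eventually.of_forall fun s => norm_nonneg _)
              (Eventually.of_forall (Ioc_subset_Ioo_right ht₁.2))
    rw [e1, le_div_iff₀ (by positivity : (0 : ℝ) < 2 * ν)]
    have h0 := hL0 t₁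
    nlinarith
  -- a sequence of times `b n ↑ T` inside `(t₀, T)`
  set b : ℕ → ℝ := fun n => T - (T - t₀) / ((n : ℝ) + 2) with hb
  have hbI : ∀ n, b n ∈ Ioo t₀ T := by
    intro n
    have hδ : 0 < T - t₀ := sub_pos.2 ht₀.2
    have hn : (0 : ℝ) < (n : ℝ) + 2 := by positivity
    have h1 : (T - t₀) / ((n : ℝ) + 2) < T - t₀ := div_lt_self hδ (by linarith)
    have h2 : 0 < (T - t₀) / ((n : ℝ) + 2) := div_pos hδ hn
    exact ⟨by simp only [hb]; linarith, by simp only [hb]; linarith⟩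
  have hbT : Tendsto b atTop (𝓝 T) := by
    have h1 : Tendsto (fun n : ℕ => (n : ℝ) + 2) atTop atTop :=
      tendsto_atTop_add_const_right _ _ tendsto_natCast_atTop_atTop
    have h2 : Tendsto (fun n : ℕ => (T - t₀) / ((n : ℝ) + 2)) atTop (𝓝 0) :=
      tendsto_const_nhds.div_atTop h1
    simpa [hb] using tendsto_const_nhds.sub h2
  -- integrability on `(t₀, T]` from the uniform bound along `b n`
  have hIoc : IntegrableOn D (Ioc t₀ T) := by
    refine integrableOn_Ioc_of_intervalIntegral_norm_bounded_right (I := M / (2 * ν)) (b := b)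
      (l := atTop) (fun n => ?_) hbT (Eventually.of_forall fun n => hbound (b n)
        ⟨(hbI n).1.le, (hbI n).2⟩)
    have hsub : Icc t₀ (b n) ⊆ Ioo 0 T :=
      fun s hs => ⟨ht₀.1.trans_le hs.1, hs.2.trans_lt (hbI n).2⟩
    exact ((cD.mono hsub).integrableOn_Icc).mono_set Ioc_subset_Icc_self
  exact hIoc.mono_set Ioo_subset_Ioc_self

/-- **The cut-off energy has a left limit at the blow-up time** (no Type-I hypothesis): for the
item's classical Leray–Hopf solution, `0 ≤ φ ∈ C_c^∞(ℝ³)` and `t₀ ∈ (0, T)`,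
`∫ φ|u(t)|² → ∫ φ|u(t₀)|² − 2ν ∫_{(t₀,T)}∫|∇u|²φ + ∫_{(t₀,T)} F_φ` as `t ↑ T` (the identity below
`T` and the integrability of both time integrands up to `T`). [cite: LeslieShvydkoy2017, Thm. 1.2] -/
theorem tendsto_integral_cutoff_normSq_nhdsLT {ν T : ℝ} (hν : 0 < ν) (hT : 0 < T)
    {u : ℝ → EuclideanSpace ℝ (Fin 3) → EuclideanSpace ℝ (Fin 3)}
    {p : ℝ → EuclideanSpace ℝ (Fin 3) → ℝ}
    (hcl : IsClassicalNSSolutionOn (Set.Ico 0 T) ν 0 u p) (hLH : IsLerayHopfOn T ν 0 (u 0) u)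
    {φ : EuclideanSpace ℝ (Fin 3) → ℝ} (hφ : ContDiff ℝ ∞ φ) (hφc : HasCompactSupport φ)
    (hφ0 : ∀ x, 0 ≤ φ x) {t₀ : ℝ} (ht₀ : t₀ ∈ Ioo 0 T) :
    Tendsto (fun t => ∫ x, φ x * ‖u t x‖ ^ 2) (𝓝[<] T)
      (𝓝 ((∫ x, φ x * ‖u t₀ x‖ ^ 2) -
        2 * ν * (∫ s in Ioo t₀ T, ∫ x, frobeniusNormSq (fderiv ℝ (u s) x) * φ x) +
        ∫ s in Ioo t₀ T, ∫ x, (ν * ((Δ φ) x * ‖u s x‖ ^ 2) +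
          fderiv ℝ φ x (u s x) * ‖u s x‖ ^ 2 + 2 * (p s x * fderiv ℝ φ x (u s x))))) := by
  have hcl' : IsClassicalNSSolutionOn (Ioo 0 T) ν 0 u p :=
    hcl.mono Ioo_subset_Ico_self isOpen_Ioo.uniqueDiffOn
  have hD := tendsto_intervalIntegral_nhdsLT ht₀.2
    (integrableOn_dissipation_Ioo hν hT hcl hLH hφ hφc hφ0 ht₀)
  have hF := tendsto_intervalIntegral_nhdsLT ht₀.2
    ((integrableOn_flux_Ioo hν hT hcl hLH hφ hφc).mono_set (Ioo_subset_Ioo_left ht₀.1.le))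
  have hlim := ((tendsto_const_nhds (x := ∫ x, φ x * ‖u t₀ x‖ ^ 2)).sub
    (hD.const_mul (2 * ν))).add hF
  refine hlim.congr' ?_
  filter_upwards [Ioo_mem_nhdsLT ht₀.2] with t₁ ht₁
  have hI : Icc t₀ t₁ ⊆ Ioo 0 T := fun s hs => ⟨ht₀.1.trans_le hs.1, hs.2.trans_lt ht₁.2⟩
  have hid := hcl'.local_energy_identity_cutoff isOpen_Ioo hφ hφc ht₁.1.le hI
  linarith

/-- **No concentration for the cut-off energy** (Type I): for the item's solution, Type I in time
at `T`, and every continuous compactly supported weight `φ`, `∫ φ|u(t)|² → ∫ φ|u(T)|²` as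
`t ↑ T`. Proof: `∫φ|u(t)|² − ∫φ|u(T)|² = 2(∫⟪u(t), φu(T)⟫ − ∫⟪u(T), φu(T)⟫) + ∫ φ|u(t) − u(T)|²`;
the first term tends to `0` by the weak `L²` continuity of the Leray–Hopf slices (`φ u(T) ∈ L²`),
the second is at most `‖φ‖_∞ ∫_{B} |u(t) − u(T)|²` over a ball `B ⊇ supp φ`, which tends to `0`
by the no-concentration theorem `tendsto_localEnergy_sub_top`.
[cite: LeslieShvydkoy2017, Thm. 1.2] -/
theorem tendsto_integral_cutoff_normSq_top {ν T : ℝ} (hν : 0 < ν) (hT : 0 < T)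
    {u : ℝ → EuclideanSpace ℝ (Fin 3) → EuclideanSpace ℝ (Fin 3)}
    {p : ℝ → EuclideanSpace ℝ (Fin 3) → ℝ}
    (hcl : IsClassicalNSSolutionOn (Set.Ico 0 T) ν 0 u p) (hLH : IsLerayHopfOn T ν 0 (u 0) u)
    (hTI : IsTypeIBlowup u T)
    {φ : EuclideanSpace ℝ (Fin 3) → ℝ} (hφ : Continuous φ) (hφc : HasCompactSupport φ) :
    Tendsto (fun t => ∫ x, φ x * ‖u t x‖ ^ 2) (𝓝[<] T) (𝓝 (∫ x, φ x * ‖u T x‖ ^ 2)) := by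
  -- a ball containing the support of `φ`, and a bound of `φ`
  obtain ⟨R, hR⟩ := hφc.isCompact.isBounded.subset_ball (0 : EuclideanSpace ℝ (Fin 3))
  obtain ⟨Φ, hΦ⟩ := hφ.bounded_above_of_compact_support hφc
  have hΦ0 : 0 ≤ Φ := (norm_nonneg _).trans (hΦ 0)
  have hφK : ∀ x ∉ ball (0 : EuclideanSpace ℝ (Fin 3)) R, φ x = 0 :=
    fun x hx => image_eq_zero_of_notMem_tsupport fun h => hx (hR h)
  have hφm : AEStronglyMeasurable φ volume := hφ.aestronglyMeasurable
  -- the `L²` slices and the test field `w = φ u(T) ∈ L²`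
  have hUT : MemLp (u T) 2 volume := hLH.memLp T ⟨hT.le, le_rfl⟩
  set w : EuclideanSpace ℝ (Fin 3) → EuclideanSpace ℝ (Fin 3) := fun x => φ x • u T x with hw_def
  have hw : MemLp w 2 volume := by
    refine MemLp.of_le_mul (c := Φ) hUT (hφm.smul hUT.aestronglyMeasurable)
      (Eventually.of_forall fun x => ?_)
    rw [hw_def, norm_smul]
    exact mul_le_mul_of_nonneg_right (hΦ x) (norm_nonneg _)
  -- weighted integrability of squares of `L²` functions
  have hint2 : ∀ g : EuclideanSpace ℝ (Fin 3) → EuclideanSpace ℝ (Fin 3), MemLp g 2 volume →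
      Integrable fun x => φ x * ‖g x‖ ^ 2 := fun g hg =>
    (hg.integrable_norm_pow two_ne_zero).bdd_mul hφm (Eventually.of_forall hΦ)
  -- Step 1: the weak term tends to zero
  have hweak : Tendsto (fun t => ∫ x, ⟪u t x, w x⟫) (𝓝[<] T) (𝓝 (∫ x, ⟪u T x, w x⟫)) := by
    have hc := (hLH.weak_continuous w hw).1
    have hcT : ContinuousWithinAt (fun t => ∫ x, ⟪u t x, w x⟫) (Ioc 0 T) T := hc T ⟨hT, le_rfl⟩
    rw [← nhdsWithin_Ioo_eq_nhdsLT hT]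
    exact hcT.tendsto.mono_left (nhdsWithin_mono _ Ioo_subset_Ioc_self)
  -- Step 2: the norm term tends to zero (no concentration on the ball `B(0,R)`)
  have hnc : Tendsto (fun t => (∫⁻ z in ball (0 : EuclideanSpace ℝ (Fin 3)) R,
      ‖u t z - u T z‖ₑ ^ 2).toReal) (𝓝[<] T) (𝓝 0) := by
    have h := tendsto_localEnergy_sub_top hν hT hcl hLH hTI 0 R
    have := (ENNReal.tendsto_toReal ENNReal.zero_ne_top).comp h
    simpa [Function.comp_def] using this
  have hnorm : ∀ t ∈ Icc 0 T, |∫ x, φ x * ‖u t x - u T x‖ ^ 2| ≤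
      Φ * (∫⁻ z in ball (0 : EuclideanSpace ℝ (Fin 3)) R, ‖u t z - u T z‖ₑ ^ 2).toReal := by
    intro t ht
    have hUt : MemLp (u t) 2 volume := hLH.memLp t ht
    have hdiff : MemLp (fun x => u t x - u T x) 2 volume := hUt.sub hUT
    have hsq : Integrable fun x => ‖u t x - u T x‖ ^ 2 := hdiff.integrable_norm_pow two_ne_zero
    -- `|∫ φ g| ≤ ∫ |φ| g = ∫_B |φ| g ≤ Φ ∫_B g`
    have h1 : |∫ x, φ x * ‖u t x - u T x‖ ^ 2| ≤ ∫ x, |φ x| * ‖u t x - u T x‖ ^ 2 := by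
      refine (abs_integral_le_integral_abs).trans (le_of_eq (integral_congr_ae
        (Eventually.of_forall fun x => ?_)))
      simp only [abs_mul, abs_pow, abs_norm]
    have h2 : ∫ x, |φ x| * ‖u t x - u T x‖ ^ 2 =
        ∫ x in ball (0 : EuclideanSpace ℝ (Fin 3)) R, |φ x| * ‖u t x - u T x‖ ^ 2 := by
      refine (setIntegral_eq_integral_of_forall_compl_eq_zero fun x hx => ?_).symm
      rw [hφK x hx, abs_zero, zero_mul]
    have hsqB : IntegrableOn (fun x => ‖u t x - u T x‖ ^ 2)
        (ball (0 : EuclideanSpace ℝ (Fin 3)) R) := hsq.integrableOn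
    have h3 : ∫ x in ball (0 : EuclideanSpace ℝ (Fin 3)) R, |φ x| * ‖u t x - u T x‖ ^ 2 ≤
        ∫ x in ball (0 : EuclideanSpace ℝ (Fin 3)) R, Φ * ‖u t x - u T x‖ ^ 2 := by
      refine integral_mono_of_nonneg (Eventually.of_forall fun x => by positivity)
        (hsqB.const_mul Φ) (Eventually.of_forall fun x => ?_)
      exact mul_le_mul_of_nonneg_right ((Real.norm_eq_abs _).symm.trans_le (hΦ x))
        (sq_nonneg _)
    have h4 : ∫ x in ball (0 : EuclideanSpace ℝ (Fin 3)) R, ‖u t x - u T x‖ ^ 2 =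
        (∫⁻ z in ball (0 : EuclideanSpace ℝ (Fin 3)) R, ‖u t z - u T z‖ₑ ^ 2).toReal := by
      rw [integral_eq_lintegral_of_nonneg_ae (Eventually.of_forall fun x => sq_nonneg _)
        hsqB.aestronglyMeasurable]
      congr 1
      refine lintegral_congr fun x => ?_
      rw [← ofReal_norm, ← ENNReal.ofReal_pow (norm_nonneg _)]
    calc |∫ x, φ x * ‖u t x - u T x‖ ^ 2|
        ≤ ∫ x in ball (0 : EuclideanSpace ℝ (Fin 3)) R, |φ x| * ‖u t x - u T x‖ ^ 2 :=
          h1.trans (le_of_eq h2)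
      _ ≤ ∫ x in ball (0 : EuclideanSpace ℝ (Fin 3)) R, Φ * ‖u t x - u T x‖ ^ 2 := h3
      _ = Φ * (∫⁻ z in ball (0 : EuclideanSpace ℝ (Fin 3)) R, ‖u t z - u T z‖ₑ ^ 2).toReal := by
          rw [integral_const_mul, h4]
  -- Step 3: the decomposition `∫φ|u(t)|² − ∫φ|u(T)|² = 2(∫⟪u t, w⟫ − ∫⟪u T, w⟫) + ∫φ|u t − u T|²`
  have hdec : ∀ t ∈ Icc 0 T, (∫ x, φ x * ‖u t x‖ ^ 2) - ∫ x, φ x * ‖u T x‖ ^ 2 =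
      2 * ((∫ x, ⟪u t x, w x⟫) - ∫ x, ⟪u T x, w x⟫) + ∫ x, φ x * ‖u t x - u T x‖ ^ 2 := by
    intro t ht
    have hUt : MemLp (u t) 2 volume := hLH.memLp t ht
    have i1 := hint2 (u t) hUt
    have i2 := hint2 (u T) hUT
    have i3 : Integrable fun x => ⟪u t x, w x⟫ := integrable_inner_of_memLp_two hUt hw
    have i4 : Integrable fun x => ⟪u T x, w x⟫ := integrable_inner_of_memLp_two hUT hw
    have i5 : Integrable fun x => φ x * ‖u t x - u T x‖ ^ 2 :=
      hint2 (fun x => u t x - u T x) (hUt.sub hUT)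
    have i34 : Integrable fun x => 2 * (⟪u t x, w x⟫ - ⟪u T x, w x⟫) := (i3.sub i4).const_mul 2
    rw [← integral_sub i1 i2, ← integral_sub i3 i4, ← integral_const_mul, ← integral_add i34 i5]
    refine integral_congr_ae (Eventually.of_forall fun x => ?_)
    simp only [hw_def, real_inner_smul_right, real_inner_self_eq_norm_sq, norm_sub_sq_real]
    ring
  -- Step 4: assemble
  have hsum : Tendsto (fun t => (∫ x, φ x * ‖u T x‖ ^ 2) +
      (2 * ((∫ x, ⟪u t x, w x⟫) - ∫ x, ⟪u T x, w x⟫) + ∫ x, φ x * ‖u t x - u T x‖ ^ 2))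
      (𝓝[<] T) (𝓝 ((∫ x, φ x * ‖u T x‖ ^ 2) + (2 * 0 + 0))) := by
    refine tendsto_const_nhds.add ((Tendsto.const_mul 2 ?_).add ?_)
    · simpa using hweak.sub_const (∫ x, ⟪u T x, w x⟫)
    · refine squeeze_zero_norm' ?_ (by simpa using hnc.const_mul Φ)
      filter_upwards [Ioo_mem_nhdsLT hT] with t ht
      rw [Real.norm_eq_abs]
      exact hnorm t ⟨ht.1.le, ht.2.le⟩
  simp only [mul_zero, add_zero] at hsum
  refine hsum.congr' ?_
  filter_upwards [Ioo_mem_nhdsLT hT] with t ht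
  have := hdec t ⟨ht.1.le, ht.2.le⟩
  linarith

/-- **The local energy identity up to and including a Type-I blow-up time** (no anomalous
dissipation). Let `(u, p)` be a classical solution of the Navier–Stokes system with viscosity
`ν > 0` on `[0, T) × ℝ³` which is Leray–Hopf on `[0, T)` and blows up at `T` at the Type-I rate in
time (the binders of the item `TerminalTrace.TypeITraceScarL3`). Then for every cut-off
`0 ≤ φ ∈ C_c^∞(ℝ³)` and every `t₀ ∈ (0, T)`, both `∫|∇u|²φ` and the flux are integrable on
`(t₀, T)` and
`∫ φ|u(T)|² − ∫ φ|u(t₀)|² + 2ν ∫_{(t₀,T)} ∫ |∇u|² φ = ∫_{(t₀,T)} ∫ (νΔφ |u|² + Dφ(u)|u|² + 2 p Dφ(u))`: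
the Caffarelli–Kohn–Nirenberg local energy inequality is an equality at the blow-up time for every
cut-off, at every centre (backward-singular vertices included). In print in substance:
Leslie–Shvydkoy 2018, Thm. 1.2 (Type I in time ⇒ energy equality).
[cite: LeslieShvydkoy2017, Thm. 1.2; CaffarelliKohnNirenberg1982, §2 (2.5)] -/
theorem localEnergyIdentity_top {ν T : ℝ} (hν : 0 < ν) (hT : 0 < T)
    {u : ℝ → EuclideanSpace ℝ (Fin 3) → EuclideanSpace ℝ (Fin 3)}
    {p : ℝ → EuclideanSpace ℝ (Fin 3) → ℝ}
    (hcl : IsClassicalNSSolutionOn (Set.Ico 0 T) ν 0 u p) (hLH : IsLerayHopfOn T ν 0 (u 0) u)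
    (hTI : IsTypeIBlowup u T)
    {φ : EuclideanSpace ℝ (Fin 3) → ℝ} (hφ : ContDiff ℝ ∞ φ) (hφc : HasCompactSupport φ)
    (hφ0 : ∀ x, 0 ≤ φ x) {t₀ : ℝ} (ht₀ : t₀ ∈ Ioo 0 T) :
    IntegrableOn (fun s => ∫ x, frobeniusNormSq (fderiv ℝ (u s) x) * φ x) (Ioo t₀ T) ∧
    IntegrableOn (fun s => ∫ x, (ν * ((Δ φ) x * ‖u s x‖ ^ 2) +
      fderiv ℝ φ x (u s x) * ‖u s x‖ ^ 2 + 2 * (p s x * fderiv ℝ φ x (u s x)))) (Ioo t₀ T) ∧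
    (∫ x, φ x * ‖u T x‖ ^ 2) - (∫ x, φ x * ‖u t₀ x‖ ^ 2) +
        2 * ν * (∫ s in Ioo t₀ T, ∫ x, frobeniusNormSq (fderiv ℝ (u s) x) * φ x) =
      ∫ s in Ioo t₀ T, ∫ x, (ν * ((Δ φ) x * ‖u s x‖ ^ 2) +
        fderiv ℝ φ x (u s x) * ‖u s x‖ ^ 2 + 2 * (p s x * fderiv ℝ φ x (u s x))) := by
  refine ⟨integrableOn_dissipation_Ioo hν hT hcl hLH hφ hφc hφ0 ht₀,
    (integrableOn_flux_Ioo hν hT hcl hLH hφ hφc).mono_set (Ioo_subset_Ioo_left ht₀.1.le), ?_⟩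
  have h1 := tendsto_integral_cutoff_normSq_nhdsLT hν hT hcl hLH hφ hφc hφ0 ht₀
  have h2 := tendsto_integral_cutoff_normSq_top hν hT hcl hLH hTI hφ.continuous hφc
  have := tendsto_nhds_unique h2 h1
  linarith

end Summit.NavierStokesRegularity.NavierStokesRegularity.Theorems.TypeITraceScarL3

end
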